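import Literature.NumberTheory.EllipticCurves.CasselsTateLevelAlternating
import Summits.BirchSwinnertonDyer.BirchSwinnertonDyer.Theorems.GenusKolyvaginAtTwoPowDvdShaCardAtTwoRTCrossPairVanishing
import HarnessLib

/-!
# Route `GenusKolyvaginAtTwo`, crux L_T `PowDvdShaCardAtTwoRT` (stmt-BirchSwinnertonDyer-23299), LINE 18, road (E4) — the X-ORTH
# ADAPTER, preliminaries: the `ι`-free vanishing forms, antisymmetry of the level pairing, and the sign of a `2`-torsion eigenclass

Seat `bsd-line-gk2-p5` g27 (WIDTH-5 attach, SUPPLY lineage, cell `bsd-f1-sign2`), `--supports` the crux L_T (helper; closes nothing).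
THEOREMS ONLY (no definition, no named fact, no `sorry`); BSD is not proved by any of this; neither is L_T nor any stub.

WHY.  Road (E4) closes L_T K-side from three pieces: gk2-p4's one-pair theorem (`…RTCrossPairTerm`, X-ORTH for ONE pair `(ι z, ι t)`
of opposite-sign Kolyvagin-type Selmer classes, stated through a map `ι : Sel^{(m²)} →+ Ш[m]` with `shaTorsionVal (ι z) =
torsionH1ToH1 z`), gk2-p2's capstone frame (`…RTOrthogonalCapstone(Frame)`, whose displayed socket `hOrth` quantifies over
`x x′ : Ш[2^k]` with a Selmer class `y` of recorded PROVENANCE and `↑↑x = torsionH1ToH1 y` — no `ι`), and KS.  The adapter between the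
two currencies needs three facts that wait on nothing, recorded here:

* §1 `apply_eq_zero_of_swap_eq_zero_of_alternating`, `ctLevelPairing_swap_eq_neg`, `ctLevelPairing_eq_zero_of_swap_eq_zero` — the
  level-`m` Cassels–Tate pairing is alternating (Cassels; tree `ctLevelPairing_self_eq_zero`), hence ANTISYMMETRIC: `B x x′ = −B x′ x`.
  The one-pair theorem is asymmetric (`z = m • b₁` is the class whose own primes are the CROSS places); antisymmetry lets the adapter
  choose which class of the pair plays `b₁`.
* §2 `ctLevelPairing_eq_zero_of_forall_localTerm_eq_zero'`, `ctLevelPairing_eq_zero_of_forall_cases'` — gk2-p4's §2 of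
  `…RTCrossPairVanishing` WITHOUT `ι`: for `x x′ : Ш[m]` with `shaTorsionVal x = torsionH1ToH1 z`, `shaTorsionVal x′ = torsionH1ToH1 t`
  (`ctLevelPairing_apply` only sees `shaTorsionVal`).  A global `ι` with `hι` on all of `Sel^{(m²)}` exists only when `m` kills the image
  of `Sel^{(m²)}` in `Ш`, which the capstone frame does not grant; the provenance currency needs none.
* §3 `two_smul_eq_zero_of_smul_eq_smul_neg`, `smul_eq_of_smul_eq_of_two_smul_eq_zero` — if a class is a `w`- AND a `(−w)`-eigenvector
  (`w = ±1`) it is `2`-torsion, and a `2`-torsion `w`-eigenvector is an `s`-eigenvector for every `s = ±1`.  The capstone's provenance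
  records the sign of the MULTIPLE `z = 2^{L−e} c_L(n)` as an element (`conjAct τ z = w • z`), the cross-term argument needs the sign of
  `c_L(n)` itself (Gross Prop. 5.4: `ε_n`); they differ exactly when `z` is `2`-torsion, and then §1 swaps the pair.

References: [Cassels1962ArithmeticIV] §1; [MilneADT2006] Ch. I §6 Prop. 6.9; [McCallumLMS1991] §4 Prop. 4.7, §5 Lemma 5.3, Thm. 5.4;
[GrossLMS1991] Prop. 5.4.
-/

set_option autoImplicit false

noncomputable section

open scoped Classical
open scoped AddSubgroup
open Function Field NumberField IsDedekindDomain WeierstrassCurve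
open Literature.NumberTheory.EllipticCurves Literature.NumberTheory.GaloisRepresentations
open Literature.NumberTheory.GaloisCohomology
open Literature.NumberTheory.GaloisRepresentations.DiscreteGaloisModule (mu)

-- the Theorems namespace of this sub repeats the summit name by design (D-0017 nested layout)
set_option linter.dupNamespace false

universe u

namespace Summit.BirchSwinnertonDyer.BirchSwinnertonDyer.Theorems.GenusExact.PlusDescent

/-! ## §1 Antisymmetry of an alternating bi-additive map; the level-`m` Cassels–Tate pairing -/

section Alternating

variable {G T : Type*} [AddCommGroup G] [AddCommGroup T]

/-- An alternating bi-additive map is antisymmetric: `B x y + B y x = 0`. [folklore] -/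
theorem apply_add_swap_eq_zero_of_alternating (B : G →+ G →+ T) (halt : ∀ x, B x x = 0) (x y : G) :
    B x y + B y x = 0 := by
  have h := halt (x + y)
  simp only [map_add, AddMonoidHom.add_apply, halt x, halt y, zero_add, add_zero] at h
  rwa [add_comm] at h

/-- An alternating bi-additive map is antisymmetric: `B x y = −B y x`. [folklore] -/
theorem apply_eq_neg_swap_of_alternating (B : G →+ G →+ T) (halt : ∀ x, B x x = 0) (x y : G) :
    B x y = -B y x :=
  eq_neg_of_add_eq_zero_left (apply_add_swap_eq_zero_of_alternating B halt x y)

/-- For an alternating bi-additive map, `B y x = 0 → B x y = 0`. [folklore] -/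
theorem apply_eq_zero_of_swap_eq_zero_of_alternating (B : G →+ G →+ T) (halt : ∀ x, B x x = 0) {x y : G}
    (h : B y x = 0) : B x y = 0 := by
  rw [apply_eq_neg_swap_of_alternating B halt x y, h, neg_zero]

end Alternating

section CTLevel

variable {K : Type u} [Field K] [NumberField K] (W : WeierstrassCurve K) [W.IsElliptic] (m : ℕ) [NeZero m]
variable (e : geomTorsion W ((m * m : ℕ) : ℤ) → geomTorsion W ((m * m : ℕ) : ℤ) → AlgebraicClosure K)
  (hμ : ∀ S T, e S T ^ (m * m) = 1)
  (hadd₁ : ∀ S₁ S₂ T, e (S₁ + S₂) T = e S₁ T * e S₂ T)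
  (hadd₂ : ∀ S T₁ T₂, e S (T₁ + T₂) = e S T₁ * e S T₂)
  (hgal : ∀ (σ : absoluteGaloisGroup K) (S T : geomTorsion W ((m * m : ℕ) : ℤ)), σ • e S T = e (σ • S) (σ • T))
  (inv : LocalInvariants K (m * m)) (halt : ∀ T, e T T = 1) (hPT' : inv.SumInvLocalizationEqZero)
  (hH3 : ∀ c : galoisCohomology (mu K (m * m)) 3,
    (∀ v : Place K, galoisCohomology.localization (mu K (m * m)) v 3 c = 0) → c = 0)
  (hfin : ∀ D : GeneralCaseData W m e hμ hadd₁ hadd₂ hgal, ∃ S : Finset (Place K), ∀ v ∉ S, D.localTerm inv v = 0)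

/-- **The level-`m` Cassels–Tate pairing is antisymmetric**: `B_m(x, y) = −B_m(y, x)` on `Ш(E/K)[m]` (Cassels' alternation
`ctLevelPairing_self_eq_zero`, polarised). [cite: Cassels1962ArithmeticIV, §1] [cite: MilneADT2006, Ch. I §6, Prop. 6.9] -/
theorem ctLevelPairing_swap_eq_neg (x y : (W.sha)[m]) :
    ctLevelPairing W m e hμ hadd₁ hadd₂ hgal inv halt hPT' hH3 hfin x y =
      -ctLevelPairing W m e hμ hadd₁ hadd₂ hgal inv halt hPT' hH3 hfin y x :=
  apply_eq_neg_swap_of_alternating _ (ctLevelPairing_self_eq_zero W m e hμ hadd₁ hadd₂ hgal inv halt hPT' hH3 hfin) x y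

/-- **`B_m(y, x) = 0 → B_m(x, y) = 0`** for the level-`m` Cassels–Tate pairing. [cite: Cassels1962ArithmeticIV, §1]
[cite: MilneADT2006, Ch. I §6, Prop. 6.9] -/
theorem ctLevelPairing_eq_zero_of_swap_eq_zero {x y : (W.sha)[m]}
    (h : ctLevelPairing W m e hμ hadd₁ hadd₂ hgal inv halt hPT' hH3 hfin y x = 0) :
    ctLevelPairing W m e hμ hadd₁ hadd₂ hgal inv halt hPT' hH3 hfin x y = 0 :=
  apply_eq_zero_of_swap_eq_zero_of_alternating _
    (ctLevelPairing_self_eq_zero W m e hμ hadd₁ hadd₂ hgal inv halt hPT' hH3 hfin) h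

end CTLevel

/-! ## §2 The pulled-back value vanishes — `ι`-free (provenance) forms of `…RTCrossPairVanishing` §2 -/

section Vanishing

variable {K : Type u} [Field K] [NumberField K] {W : WeierstrassCurve K} {m : ℕ} [NeZero m]
variable (e : geomTorsion W ((m * m : ℕ) : ℤ) → geomTorsion W ((m * m : ℕ) : ℤ) → AlgebraicClosure K)
  (hμ : ∀ S T, e S T ^ (m * m) = 1)
  (hadd₁ : ∀ S₁ S₂ T, e (S₁ + S₂) T = e S₁ T * e S₂ T)
  (hadd₂ : ∀ S T₁ T₂, e S (T₁ + T₂) = e S T₁ * e S T₂)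
  (hgal : ∀ (σ : absoluteGaloisGroup K) (S T : geomTorsion W ((m * m : ℕ) : ℤ)), σ • e S T = e (σ • S) (σ • T))
variable (inv : LocalInvariants K (m * m))
-- `hPT'` is the reciprocity predicate `LocalInvariants.SumInvLocalizationEqZero` on `inv`, not a named fact.
variable (halt : ∀ T, e T T = 1) (hPT' : inv.SumInvLocalizationEqZero)
  (hH3 : ∀ c : galoisCohomology (mu K (m * m)) 3,
    (∀ v : Place K, galoisCohomology.localization (mu K (m * m)) v 3 c = 0) → c = 0)
  (hfin : ∀ D : GeneralCaseData W m e hμ hadd₁ hadd₂ hgal, ∃ S : Finset (Place K), ∀ v ∉ S, D.localTerm inv v = 0)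

include halt hPT' in
/-- **`B(x, x′) = 0` when every local term vanishes — provenance form.**  `x, x′ ∈ Ш(E/K)[m]` are the images of Selmer classes
`z = m • b₁`, `t` at level `m²` (`shaTorsionVal x = torsionH1ToH1 z`, `shaTorsionVal x′ = torsionH1ToH1 t`); for ANY first-case datum
`D` with `D.b₁ = b₁`, `ι_* D.b′ = t` whose local terms vanish on `D.badSet`, the level-`m` Cassels–Tate value `B(x, x′)` is `0`
(`ctLevelPairing_apply` + `ctGeneralFun_zsmul_eq_value`: the value is the SUM of the local terms).  The `ι`-free twin of gk2-p4's
`ctLevelPairing_pullback_eq_zero_of_forall_localTerm_eq_zero`. [cite: MilneADT2006, Ch. I §6, proof of Prop. 6.9]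
[cite: McCallumLMS1991, §4 Prop. 4.7] -/
theorem ctLevelPairing_eq_zero_of_forall_localTerm_eq_zero' [W.IsElliptic] (x x' : (W.sha)[m])
    {z t : galH1Torsion W ((m * m : ℕ) : ℤ)}
    (hx : shaTorsionVal W m x = torsionH1ToH1 W ((m * m : ℕ) : ℤ) z)
    (hx' : shaTorsionVal W m x' = torsionH1ToH1 W ((m * m : ℕ) : ℤ) t)
    {b₁ : galoisCohomology (W.torsionGaloisModule ((m * m : ℕ) : ℤ)) 1} (hz : z = (m : ℤ) • b₁)
    (D : FirstCaseData W m) (hD₁ : D.b₁ = b₁)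
    (hDt : galoisCohomology.map (inclKD W m m) 1 D.b' = t)
    (h0 : ∀ v ∈ D.badSet, D.localTerm e hμ hadd₁ hadd₂ hgal inv v = 0) :
    ctLevelPairing W m e hμ hadd₁ hadd₂ hgal inv halt hPT' hH3 hfin x x' = 0 := by
  rw [ctLevelPairing_apply, hx, hx', hz, ← hDt, torsionH1ToH1_map_inclKD, ← hD₁,
    ctGeneralFun_zsmul_eq_value inv halt hPT' D, FirstCaseData.value, Finset.sum_eq_zero h0, map_zero]

include halt hPT' in
/-- **McCallum's case split, vanishing form — provenance form.**  Same `x, x′, z = m • b₁, t, D`; if at every place either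
`loc_v b₁ ∈ 𝓛_v^{(m²)}` (`v ∤ n`), or `loc_v b′ = 0` (own primes of `t`), or the local term is known to vanish (the CROSS places), then
`B(x, x′) = 0`.  The `ι`-free twin of gk2-p4's `ctLevelPairing_pullback_eq_zero_of_forall_cases`. [cite: McCallumLMS1991, §4 Prop. 4.7]
[cite: MilneADT2006, Ch. I §6, proof of Prop. 6.9] -/
theorem ctLevelPairing_eq_zero_of_forall_cases' [W.IsElliptic] (x x' : (W.sha)[m])
    {z t : galH1Torsion W ((m * m : ℕ) : ℤ)}
    (hx : shaTorsionVal W m x = torsionH1ToH1 W ((m * m : ℕ) : ℤ) z)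
    (hx' : shaTorsionVal W m x' = torsionH1ToH1 W ((m * m : ℕ) : ℤ) t)
    {b₁ : galoisCohomology (W.torsionGaloisModule ((m * m : ℕ) : ℤ)) 1} (hz : z = (m : ℤ) • b₁)
    (D : FirstCaseData W m) (hD₁ : D.b₁ = b₁)
    (hDt : galoisCohomology.map (inclKD W m m) 1 D.b' = t)
    (h : ∀ v : Place K,
      galoisCohomology.res (W.torsionGaloisModule ((m * m : ℕ) : ℤ)) (Place.Completion v) 1 b₁ ∈
          W.kummerLocalConditionAt ((m * m : ℕ) : ℤ) (Place.Completion v) ∨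
        galoisCohomology.res (W.torsionGaloisModule (m : ℤ)) (Place.Completion v) 1 D.b' = 0 ∨
          D.localTerm e hμ hadd₁ hadd₂ hgal inv v = 0) :
    ctLevelPairing W m e hμ hadd₁ hadd₂ hgal inv halt hPT' hH3 hfin x x' = 0 := by
  refine ctLevelPairing_eq_zero_of_forall_localTerm_eq_zero' e hμ hadd₁ hadd₂ hgal inv halt hPT' hH3 hfin x x' hx hx' hz D
    hD₁ hDt fun v _ ↦ ?_
  rcases h v with h₁ | h₂ | h₃
  · exact D.localTerm_eq_zero_of_res_b₁_mem inv (GeneralCaseData.hiso_of_fact (hgal := hgal) halt) (hD₁ ▸ h₁)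
  · exact D.localTerm_eq_zero_of_res_b'_eq_zero inv h₂
  · exact h₃

include halt hPT' in
/-- **From the `ι`-currency to the provenance currency.**  If a map `ι : Sel^{(m²)} →+ Ш[m]` with `shaTorsionVal (ι z) =
torsionH1ToH1 z` happens to be available, the two currencies agree: `B(x, x′) = B(ι z, ι t)` whenever `shaTorsionVal x =
torsionH1ToH1 z`, `shaTorsionVal x′ = torsionH1ToH1 t`. [cite: MilneADT2006, Ch. I §6, Prop. 6.9] -/
theorem ctLevelPairing_eq_pullback_of_shaTorsionVal_eq [W.IsElliptic]
    (ι : selmerGroup W ((m * m : ℕ) : ℤ) →+ (W.sha)[m])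
    (hι : ∀ z, shaTorsionVal W m (ι z) = torsionH1ToH1 W ((m * m : ℕ) : ℤ) z)
    (x x' : (W.sha)[m]) (z t : selmerGroup W ((m * m : ℕ) : ℤ))
    (hx : shaTorsionVal W m x = torsionH1ToH1 W ((m * m : ℕ) : ℤ) z)
    (hx' : shaTorsionVal W m x' = torsionH1ToH1 W ((m * m : ℕ) : ℤ) t) :
    ctLevelPairing W m e hμ hadd₁ hadd₂ hgal inv halt hPT' hH3 hfin x x' =
      ctLevelPairing W m e hμ hadd₁ hadd₂ hgal inv halt hPT' hH3 hfin (ι z) (ι t) := by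
  rw [ctLevelPairing_apply, ctLevelPairing_apply, hx, hx', hι, hι]

end Vanishing

/-! ## §3 The sign of a `2`-torsion eigenclass -/

section Sign

variable {A : Type*} [AddCommGroup A]

/-- If `w • z = (−w) • z` with `w = ±1` then `2 • z = 0`: a class that is BOTH a `w`- and a `(−w)`-eigenvector is `2`-torsion.
[folklore] -/
theorem two_smul_eq_zero_of_smul_eq_smul_neg {w : ℤ} (hw : w = 1 ∨ w = -1) {z : A} (h : w • z = (-w) • z) :
    (2 : ℤ) • z = 0 := by
  have h2 : (2 * w) • z = 0 := by
    rw [show (2 * w : ℤ) = w - -w by ring, sub_smul, h, sub_self]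
  rcases hw with rfl | rfl
  · simpa using h2
  · rw [show (2 : ℤ) * -1 = -2 by norm_num, neg_smul, neg_eq_zero] at h2
    exact h2

/-- A `2`-torsion class is an `s`-eigenvector of anything it is a `w`-eigenvector of, for all `s, w = ±1`: if `f z = w • z` and
`2 • z = 0` then `f z = s • z`. [folklore] -/
theorem smul_eq_of_smul_eq_of_two_smul_eq_zero {w s : ℤ} (hw : w = 1 ∨ w = -1) (hs : s = 1 ∨ s = -1) {z fz : A}
    (h : fz = w • z) (h2 : (2 : ℤ) • z = 0) : fz = s • z := by
  have hneg : -z = z := by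
    rw [neg_eq_iff_add_eq_zero, ← two_smul ℤ, h2]
  rcases hw with rfl | rfl <;> rcases hs with rfl | rfl
  · exact h
  · simp only [h, one_smul, neg_smul, hneg]
  · simp only [h, one_smul, neg_smul, hneg]
  · exact h

/-- **The dichotomy the adapter uses.**  If `f z = w • z` (recorded sign of the element) and `f z = ε • z` (true sign, `ε, w = ±1`),
then either `ε = w`, or `2 • z = 0` — and in the latter case `f z = s • z` for every `s = ±1`. [folklore] -/
theorem eq_or_two_smul_eq_zero_of_smul_eq_of_smul_eq {w ε : ℤ} (hw : w = 1 ∨ w = -1) (hε : ε = 1 ∨ ε = -1) {z fz : A}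
    (hfw : fz = w • z) (hfε : fz = ε • z) : ε = w ∨ (2 : ℤ) • z = 0 := by
  by_cases hεw : ε = w
  · exact Or.inl hεw
  · right
    have hε' : ε = -w := by omega
    subst hε'
    exact two_smul_eq_zero_of_smul_eq_smul_neg hw (hfw.symm.trans hfε)

end Sign

end Summit.BirchSwinnertonDyer.BirchSwinnertonDyer.Theorems.GenusExact.PlusDescent

end
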